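import Mathlib
import HarnessLib
import Summits.HubbardSuperconductivity.HubbardSuperconductivity.Theorems.KLProgrammeKLRegimeEngineTowerLevReadoutCloseFLinkKlEngSharp
import Summits.HubbardSuperconductivity.HubbardSuperconductivity.Theorems.KLProgrammeKLRegimeEngineTowerLevReadoutUVF

/-!
# Route `KLProgramme` — crux K3 ENGINE (stmt-HubbardSuperconductivity-20437 `KLRegimeEngineV17F2`), stub (b) v2, THE LEVELS PACKAGE (ℓ):
# «(ℓ)-ASSEMBLY-∀j» (SHARP ENVELOPE, «(ℓ)-READOUT-CE-DIM») — stub (b)'s levels clause `∀ j ≤ n, KernelNormsLevels … (K_n) j` ON THE FLOW FRAME, from the per-level closers,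
# with the E1 rows quantified UNIFORMLY in the block and the constants obtained ONCE
# (cell gate-hubbard-kl, seat hubbard-kl-k3c3-p2 g16; p4 g21's closer‴_klEng♯ `kernelNormsLevels_readoutF_klEng_sharp` (levels `j ≥ d`) ∘ this seat's RO-3 closer
#  `kernelNormsLevels_uvF_of_wgridStep` (levels `j < d`); handed over by p4 g20, STATUS l.10540)

WHY.  The registered stub (b) asks, at the flow scale `n`, for `∀ j ≤ n, KernelNormsLevels L M P Q β U μ (K_n) j`.  The per-level closers are in the tree:
`kernelNormsLevels_readoutF_klEng (d c″)` serves one read-out level `j` of one block `Kb` (`d·Kb ≤ j ≤ d(Kb+1)`, link rows discharged from the model) and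
`kernelNormsLevels_uvF_of_wgridStep` serves any level from p3's weighted grid step at `(Λ_j, F_j)` (used for `j < d`).  This file is the bookkeeping that turns
them into the levels clause: the existential constants (`C₁ C₂ C₁′ C₂′ Cinc Dinc`, `c₃′ U₀′`, `Cκ Cb CJ`) are obtained ONCE for all levels; the block index is
`Kb := j / d`; the per-block E1 rows (imports `ι₁`, `ι₂′`, six-leg cells `X′`, degree caps) are asked UNIFORMLY for every block `d·k ≤ n` at the block's own
base coupling `λ_{dk} = B·ε_{dk}` and moved to the read-out level by the monotonicity of `ε_j` in `j`; the read-out constant `A_tot` and the `CE` threshold are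
asked level by level (`A_tot` depends on `j` only through `λ_j`; one `CE` over all `j` is the numerics' choice); the levels `j < d` take p3's grid-step data at
`(Λ_j, F_j)` as families indexed by `j`.

* **`kernelNormsLevels_all_klEng_sharp (d c″)`** — the twin of `kernelNormsLevels_all_klEng` (p691583) on the SHARP read-out envelope
  (`A_tot j = A_ro + C_inc·(A′·x₁/(1−x₁) + e·(τY_j)·(y_j/(1−y_j))/(2τQ′))`, M-homogeneous like `A_ro`; p4 g21's located item «(ℓ)-READOUT-CE-DIM», STATUS l.10619): `∃ C₁ C₂ C₁′ C₂′ Cinc Dinc`, `∀ R, R.WF2 → ∃ c₃′ U₀′, ∃ Cκ Cb CJ`, then under the v1 doors, the history at scale `n`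
  (`1 ≤ n ≤ n_β+1`, `IsKLRegime U c (−n)`, `HistP klPredsV17F2 … 0 n`, `FrameOK … (K_n)`, (K5′)), `2 ≤ d`, `3 ≤ D`, a regime scale `n′ ≥ n` for the coupling,
  `1 ≤ B`: GIVEN p3's weighted grid step at `(Λ_d, F_{d−1})` with its derived constants, E1's `ι₂ X` and the derived `Ab Qb Ab′ ι₂′ X′`, the four link pins
  `κb αb crb ccb` (equational, from `Cκ Cb CJ`), the degree caps for every block `d·k ≤ n`, the law's six names and `ι₁` (equational), the derived
  `ρk Q′ Q κA Yb Y A A′ ι₃`, the blocking row, `B ≥ B₀`, the import rows `ι₁`, `ι₂′` for every block `d·k ≤ n` and the six-leg cells `X′` for every block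
  `2 ≤ k`, `d·k ≤ n` (each at `λ_{dk}`), the two doors, the read-out constants (`Atot : ℕ → ℝ` level by level), the `CE` threshold at every level `d ≤ j ≤ n`,
  the cap `card ≤ 2D+1`, the six-leg cell at every level `d ≤ j ≤ n`, and for the levels `j < d` the grid-step data at `(Λ_j, F_j)` (families `κu αu ρu cru ccu`,
  derived `nVu cFu cgu Agu Pgu Auvu Quvu`, threshold per level) ⊢ **`∀ j ≤ n, KernelNormsLevels L M P Qe β U μ (klFlowFrameU L M β U μ n) j`**.
What stays hypothetical (by class): the base grid rows at `(Λ_d, F_{d−1})` and at `(Λ_j, F_j)`, `j < d` [p3/E1 data]; `ι₁ ι₂ X` imports, six-leg cells, blocking,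
`B ≥ B₀` [E1; ι₂/X typed modulo plain/all-fixed lines, #19/#21]; the two doors and the CE thresholds [numerics]; the caps [choice of `D`].
Composition of landed theorems and elementary arithmetic (`Kb = j / d`, monotonicity of `ε_j`); nothing about the model is asserted beyond them; nothing
asserts (ℓ), any stub, K3, the margin or superconductivity.
References: BGM 2006 §2.8 (2.76)–(2.84), (2.93)–(2.98), Lemma 2.5, §3 (3.2)–(3.8) [cite: BenfattoGiulianiMastropietro2006].
-/

noncomputable section

namespace Summit.HubbardSuperconductivity.HubbardSuperconductivity.Theorems.EngineV8

set_option linter.dupNamespace false -- summit = problem name (single-conjunct summit), D-0017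

open Classical
open Real Finset Literature.MathematicalPhysics.QuantumLattice Literature.Probability.LatticeModels GrassmannAlgebra
open Literature.Probability.LatticeModels.BattleFederbush
open Literature.MathematicalPhysics.QuantumLattice.FermiRG
open Summit.HubbardSuperconductivity.HubbardSuperconductivity.Theorems.KLProgrammeLegKernels
open Summit.HubbardSuperconductivity.HubbardSuperconductivity.Theorems.KLRegimeSplit
open Summit.HubbardSuperconductivity.HubbardSuperconductivity.Theorems.KLRegimeWick
open Summit.HubbardSuperconductivity.HubbardSuperconductivity.Theorems.TorusFourierL2
open Summit.HubbardSuperconductivity.HubbardSuperconductivity.Theorems.DispersionFlow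

variable {L M : ℕ} [NeZero L] [NeZero M]

set_option maxHeartbeats 400000 in -- one ~200-binder composition instantiated per level
/-- **STUB (b)'s LEVELS CLAUSE ON THE FLOW FRAME, FROM THE PER-LEVEL CLOSERS, SHARP ENVELOPE** («(ℓ)-ASSEMBLY-∀j» on «(ℓ)-READOUT-CE-DIM»): see the module docstring for the binder list and for what
stays hypothetical; conclusion `∀ j ≤ n, KernelNormsLevels L M P Qe β U μ (klFlowFrameU L M β U μ n) j`.
[cite: BenfattoGiulianiMastropietro2006, §2.8 (2.76)-(2.84), (2.93)-(2.98), Lemma 2.5 (2.98), §3 (3.2)-(3.8)] -/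
theorem kernelNormsLevels_all_klEng_sharp (d : ℕ) (c'' : ℝ) (hc'' : 0 < c'') :
    ∃ C₁ C₂ C₁' C₂' Cinc Dinc : ℝ, 0 < C₁ ∧ 0 < C₂ ∧ 0 < C₁' ∧ 0 < C₂' ∧ 0 < Cinc ∧ 1 ≤ Dinc ∧
    ∀ R : RenConsts, R.WF2 → ∃ c₃' : ℝ, 0 < c₃' ∧ ∃ U₀' : ℝ, 0 < U₀' ∧
      ∃ Cκ Cb CJ : ℝ, 0 < Cκ ∧ 0 < Cb ∧ 0 < CJ ∧
      ∀ (G : GeoConsts) (P : SplitConsts) (Qh : EngConsts) (c : ℝ), P.WF → 0 < c → c ≤ klEngC₃6 P R → c ≤ c₃' →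
      ∀ μ ∈ klWindowC, ∀ U : ℝ, 0 < U → U ≤ klEngU₀9 P R c → U ≤ U₀' → c'' * U ≤ 1 → ∀ β : ℝ, klBetaMin ≤ β → β ≤ Real.exp (c / U ^ 2) →
      ∀ (L M : ℕ) [NeZero L] [NeZero M], klEngL₃ β U ≤ L → klEngM₃ β U L ≤ M →
      ∀ n : ℕ, 1 ≤ n → n ≤ nScales β + 1 → IsKLRegime U c (-(n : ℤ)) →
        HistP klPredsV17F2 L M G P Qh R β U μ 0 n → FrameOK R U (nScales β) μ (klFlowFrameU L M β U μ n) →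
        (∀ m, 1 ≤ m → m < n → FlowPieceOscAt L M c'' β U μ m) →
      2 ≤ d → ∀ D : ℕ, 3 ≤ D →
      ∀ (cc : ℝ) (n' : ℕ), IsKLRegime U cc (-(n' : ℤ)) → n ≤ n' →
      ∀ (B : ℝ), 1 ≤ B →
      -- p3's weighted grid step hypotheses at the cutoff `Λ_d`, analysis family `F_{d−1}`, rate `jw`
      ∀ (jw : ℕ) (κ : ℝ), 0 < κ →
        IsGramBoundedR ((hubbardGridSub L M β (2 * (2 * M))).transpose * hubbardCovAboveCT L M β μ 0 (klFlowFrameU L M β U μ n) (klScale klE0 d) *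
          hubbardGridSub L M β (2 * (2 * M))) κ →
      ∀ (αw : ℝ), 0 < αw →
        (∀ X, ∑ Y, ‖((hubbardGridSub L M β (2 * (2 * M))).transpose * hubbardCovAboveCT L M β μ 0 (klFlowFrameU L M β U μ n) (klScale klE0 d) *
          hubbardGridSub L M β (2 * (2 * M))) X Y‖ * gridLabelWt L (2 * (2 * M)) β {gridLegPos X, gridLegPos Y} ≤ αw) →
        (∀ Y, ∑ X, ‖((hubbardGridSub L M β (2 * (2 * M))).transpose * hubbardCovAboveCT L M β μ 0 (klFlowFrameU L M β U μ n) (klScale klE0 d) *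
          hubbardGridSub L M β (2 * (2 * M))) X Y‖ * gridLabelWt L (2 * (2 * M)) β {gridLegPos X, gridLegPos Y} ≤ αw) →
      ∀ (ρ : ℝ), 0 < ρ →
        Real.exp 1 * αw * normV (GridLeg (GridPoint L (2 * (2 * M)))) κ ρ
          (fun m' : ℕ => if m' = 1 then |β| / (2 * (2 * M) : ℕ) * ∑ z : TorusSite 2 L, ‖framePosKernel L (klFlowFrameU L M β U μ n) z‖ * (1 + torusSiteDist z 0)
            else if m' = 2 then |U| * |β| / (2 * (2 * M) : ℕ) else 0) / κ ^ 2 < 1 →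
      ∀ (crw ccw : ℝ), 0 < crw → 0 < ccw →
        (∀ X'' : SpaceTimeIdx L M × SectorLeg (sectorCount (d - 1)), ∑ X' : GridLeg (GridPoint L (2 * (2 * M))),
          ‖(sectorAnalysisMatrix L M β (klAnisoFamily L M β μ (klFlowFrameU L M β U μ n) klE0 (d - 1)) * hubbardGridSub L M β (2 * (2 * M))) X'' X'‖ *
            gridLabelWt L (2 * (2 * M)) β {latticeLegPos (2 * (2 * M)) X'', gridLegPos X'} ≤ crw) →
        (∀ X' : GridLeg (GridPoint L (2 * (2 * M))), ∑ X'' : SpaceTimeIdx L M × SectorLeg (sectorCount (d - 1)),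
          ‖(sectorAnalysisMatrix L M β (klAnisoFamily L M β μ (klFlowFrameU L M β U μ n) klE0 (d - 1)) * hubbardGridSub L M β (2 * (2 * M))) X'' X'‖ *
            gridLabelWt L (2 * (2 * M)) β {latticeLegPos (2 * (2 * M)) X'', gridLegPos X'} ≤ ccw) →
      -- the derived base constants (equational binders)
      ∀ (nV cF cg Ag Pg : ℝ),
        nV = normV (GridLeg (GridPoint L (2 * (2 * M)))) κ ρ
          (fun m' : ℕ => if m' = 1 then |β| / (2 * (2 * M) : ℕ) * ∑ z : TorusSite 2 L, ‖framePosKernel L (klFlowFrameU L M β U μ n) z‖ * (1 + torusSiteDist z 0)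
            else if m' = 2 then |U| * |β| / (2 * (2 * M) : ℕ) else 0) →
        cF = (Real.exp 2 * (κ + ρ)) ^ (2 * 2) * (|β| / (2 * (2 * M) : ℕ)) → cg = Real.exp 1 * αw * cF / κ ^ 2 →
        Ag = crw * Real.exp 1 * cF / (ccw * cg ^ 2) → Pg = ccw ^ 2 * cg / (ρ ^ 2 * (1 - Real.exp 1 * αw * nV / κ ^ 2)) →
      ∀ (ι₂ X : ℝ), 0 ≤ ι₂ → 0 ≤ X →
      ∀ (Ab Qb Ab' ι₂' X' : ℝ), Ab = (2 : ℝ) ^ (7 * (d - 1)) * Ag / P.Klam ^ 2 → Qb = Pg / (8 : ℝ) ^ (d - 1) →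
        Ab' = Ab / B ^ 2 → ι₂' = ι₂ / B → X' = X / B ^ 2 →
      -- the floor LINK data DISCHARGED on the flow frame (`linkDataPartialF_klEng'`): the four k-free constants pinned, the degree cap kept
      ∀ (κb αb crb ccb : ℝ), κb = Real.sqrt (2 * Cκ * klE0) → αb = Cb * ((M : ℝ) / β) * (4 : ℝ) ^ d / klE0 →
        crb = 81 * CJ * M / β → ccb = 162 * CJ * M / β →
      (∀ k, 1 ≤ k → d * k ≤ n → Fintype.card (SpaceTimeIdx L M × SectorLeg (sectorCount (d * k - 1))) / 2 ≤ D) →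
      -- the law's six names PINNED by the link (equational binders), and the import `ι₁`
      ∀ (W Z σ Φ ψ τ ι₁ : ℝ), W = 64 * (27 : ℝ) ^ 4 * exp 2 * crb / ccb → Z = exp 4 * ccb ^ 2 * imagTimeWeight β M ^ 2 / 8 →
        σ = κb ^ 2 / (exp 4 * ccb ^ 2) → Φ = 9 * αb * ccb / ((27 : ℝ) ^ 5 * exp 1 * κb ^ 2 * crb) → ψ = exp 4 * ccb ^ 2 / κb ^ 2 →
        τ = exp 2 * κb ^ 2 / ccb ^ 2 → 0 ≤ ι₁ →
      ∀ (ρk Q' Q κA Yb Y A A' ι₃ : ℝ), ρk = max 4 (2 * τ * ψ) → Q' = Z * Qb + 1 → Q = ρk * Q' →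
        κA = W * ((27 : ℝ) ^ 5 * (C₁ / C₂) * (8 : ℝ) ^ (d - 1)) →
        Yb = ι₂ / (2 * Q') + W * Z ^ 3 * X / (4 * Q' ^ 2) + (W * (27 : ℝ) ^ 5 * Ab + κA * Ab) * Q' / 2 →
        Y = ι₂' / (2 * Q') + W * Z ^ 3 * X' / (4 * Q' ^ 2) + (W * (27 : ℝ) ^ 5 * Ab' + κA * Ab') * Q' / 2 →
        A = 2 * Y * (1 - ((2 : ℝ) ^ d)⁻¹) / (κA * Q') →
        A' = (W * (27 : ℝ) ^ 5 * Ab' + κA * Ab') + 2 * Y / Q' → ι₃ = W * Z ^ 3 * X' + A' * Q' ^ 3 →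
      max 1 Z * C₂ ^ 2 * max 4 (2 * τ * ψ) ≤ (2 : ℝ) ^ (d - 1) →
      max 1 (max (8 * Φ * τ * Yb) (128 * exp 1 * ψ ^ 3 * τ ^ 4 * Φ * κA * Yb / ((1 - ((2 : ℝ) ^ d)⁻¹) * ρk ^ 3))) ≤ B →
      -- E1's imports and six-leg cells, block by block, each at the block's own base level `λ_{dk} = B·ε_{dk}` (monotone in the level)
      (∀ k, 1 ≤ k → d * k ≤ n → W * Z ^ 1 * klTowerMuLevF L M β U μ (klFlowFrameU L M β U μ n) d k 1 ≤ ι₁ * (B * epsCoupling P U (d * k))) →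
      (∀ k, 1 ≤ k → d * k ≤ n → W * Z ^ 2 * klTowerMuLevF L M β U μ (klFlowFrameU L M β U μ n) d k 2 ≤ ι₂' * (B * epsCoupling P U (d * k))) →
      (∀ k, 2 ≤ k → d * k ≤ n → klTowerMuLevAtF L M β U μ (klFlowFrameU L M β U μ n) d 0 k 3 ≤ X' * (B * epsCoupling P U (d * k)) ^ 2) →
      U ≤ min 1 (min (1 / (8 * σ * Q' + 1)) (min (1 / (2 * exp 1 * τ * Q' + 1)) (min (1 / (4 * Φ * τ * ι₁ + 1))
        (min (1 / (2 * (Φ * (exp 1 * τ * ι₁ + (exp 1 * τ) ^ 2 * ι₂' + (exp 1 * τ) ^ 3 * ι₃ + A' * (exp 1 * τ * Q') ^ 2 / 2)) + 1))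
          (min (A * Q ^ 3 / (16 * σ * Q' * A' * (4 * Q') ^ 3 + A * Q ^ 3))
            (A * Q ^ 3 / (16 * exp 1 * ψ * (2 * τ * ψ * Q') ^ 2 * Φ * τ ^ 2 * ι₁ ^ 2 + A * Q ^ 3))))))) / (2 * B * P.Klam + 1) →
      cc ≤ min 1 (min (1 / (8 * σ * Q' + 1)) (min (1 / (2 * exp 1 * τ * Q' + 1)) (min (1 / (4 * Φ * τ * ι₁ + 1))
        (min (1 / (2 * (Φ * (exp 1 * τ * ι₁ + (exp 1 * τ) ^ 2 * ι₂' + (exp 1 * τ) ^ 3 * ι₃ + A' * (exp 1 * τ * Q') ^ 2 / 2)) + 1))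
          (min (A * Q ^ 3 / (16 * σ * Q' * A' * (4 * Q') ^ 3 + A * Q ^ 3))
            (A * Q ^ 3 / (16 * exp 1 * ψ * (2 * τ * ψ * Q') ^ 2 * Φ * τ ^ 2 * ι₁ ^ 2 + A * Q ^ 3))))))) * Real.log 4 / (2 * B * P.Klam + 1) →
      -- the read-out constants (equational binders; `Atot` level by level through `λ_j = B·ε_j`), the public constant's threshold at every level `d ≤ j ≤ n`,
      -- the degree cap, the six-leg cells at every level `d ≤ j ≤ n`
      ∀ (Aro Qro Qtot : ℝ) (Atot : ℕ → ℝ), Aro = (27 : ℝ) ^ 5 * (C₁' / C₂') * (Ab' + (8 : ℝ) ^ (d - 1) * (A / (1 - ((2 : ℝ) ^ d)⁻¹))) →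
        Qro = C₂' ^ 2 * max Qb (((2 : ℝ) ^ (d - 1))⁻¹ * max Q Qb) → Qtot = Dinc * max 1 (max Qro (max (4 * Q') (2 * τ * ψ * Q'))) →
        (∀ j : ℕ, Atot j = Aro + Cinc * (A' * (4 * σ * (B * epsCoupling P U j) * Q' / (1 - 4 * σ * (B * epsCoupling P U j) * Q')) +
          exp 1 * (τ * (ι₁ * (B * epsCoupling P U j) + ι₂' / (2 * Q') + ι₃ / (4 * Q' ^ 2) + A' * Q' / 4)) *
            (Φ * (τ * (ι₁ * (B * epsCoupling P U j) + ι₂' / (2 * Q') + ι₃ / (4 * Q' ^ 2) + A' * Q' / 4)) /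
              (1 - Φ * (τ * (ι₁ * (B * epsCoupling P U j) + ι₂' / (2 * Q') + ι₃ / (4 * Q' ^ 2) + A' * Q' / 4)))) / (2 * τ * Q'))) →
      ∀ Qe : EngConsts, (∀ j : ℕ, d ≤ j → j ≤ n → Qtot * imagTimeWeight β M ^ 2 * B * max 1 (Atot j / imagTimeWeight β M) ≤ Qe.CE) →
      Fintype.card (HubbardFieldIdx L M) ≤ 2 * D + 1 →
      (∀ j : ℕ, d ≤ j → j ≤ n → ∀ Ωe : Fin (2 * 3) → Option (SectorLeg (sectorCount j)), levelCount Ωe = 1 →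
        klAnisoLegKernelNormAt L M β U μ (klFlowFrameU L M β U μ n) klE0 j (2 * 3) Ωe ≤ Qe.CE ^ 3 * (epsCoupling P U j) ^ 2 * (2 : ℝ) ^ ((4 : ℤ) * j)) →
      -- the levels below the tower, `j < d` (block 0): p3's weighted grid step at `(Λ_j, F_j)`, level by level (RO-3's closer `kernelNormsLevels_uvF_of_wgridStep`)
      ∀ (jwu : ℕ → ℕ) (κu αu ρu cru ccu : ℕ → ℝ),
      (∀ j : ℕ, j < d → j ≤ n →
        0 < κu j ∧
        IsGramBoundedR ((hubbardGridSub L M β (2 * (2 * M))).transpose * hubbardCovAboveCT L M β μ 0 (klFlowFrameU L M β U μ n) (klScale klE0 j) *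
          hubbardGridSub L M β (2 * (2 * M))) (κu j) ∧
        0 < αu j ∧
        (∀ X, ∑ Y, ‖((hubbardGridSub L M β (2 * (2 * M))).transpose * hubbardCovAboveCT L M β μ 0 (klFlowFrameU L M β U μ n) (klScale klE0 j) *
          hubbardGridSub L M β (2 * (2 * M))) X Y‖ * gridLabelWt L (2 * (2 * M)) β {gridLegPos X, gridLegPos Y} ≤ αu j) ∧
        (∀ Y, ∑ X, ‖((hubbardGridSub L M β (2 * (2 * M))).transpose * hubbardCovAboveCT L M β μ 0 (klFlowFrameU L M β U μ n) (klScale klE0 j) *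
          hubbardGridSub L M β (2 * (2 * M))) X Y‖ * gridLabelWt L (2 * (2 * M)) β {gridLegPos X, gridLegPos Y} ≤ αu j) ∧
        0 < ρu j ∧
        Real.exp 1 * αu j * normV (GridLeg (GridPoint L (2 * (2 * M)))) (κu j) (ρu j)
          (fun m' : ℕ => if m' = 1 then |β| / (2 * (2 * M) : ℕ) * ∑ z : TorusSite 2 L, ‖framePosKernel L (klFlowFrameU L M β U μ n) z‖ * (1 + torusSiteDist z 0)
            else if m' = 2 then |U| * |β| / (2 * (2 * M) : ℕ) else 0) / κu j ^ 2 < 1 ∧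
        0 < cru j ∧ 0 < ccu j ∧
        (∀ X'' : SpaceTimeIdx L M × SectorLeg (sectorCount j), ∑ X' : GridLeg (GridPoint L (2 * (2 * M))),
          ‖(sectorAnalysisMatrix L M β (klAnisoFamily L M β μ (klFlowFrameU L M β U μ n) klE0 j) * hubbardGridSub L M β (2 * (2 * M))) X'' X'‖ *
            gridLabelWt L (2 * (2 * M)) β {latticeLegPos (2 * (2 * M)) X'', gridLegPos X'} ≤ cru j) ∧
        (∀ X' : GridLeg (GridPoint L (2 * (2 * M))), ∑ X'' : SpaceTimeIdx L M × SectorLeg (sectorCount j),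
          ‖(sectorAnalysisMatrix L M β (klAnisoFamily L M β μ (klFlowFrameU L M β U μ n) klE0 j) * hubbardGridSub L M β (2 * (2 * M))) X'' X'‖ *
            gridLabelWt L (2 * (2 * M)) β {latticeLegPos (2 * (2 * M)) X'', gridLegPos X'} ≤ ccu j)) →
      ∀ (nVu cFu cgu Agu Pgu Auvu Quvu : ℕ → ℝ),
      (∀ j : ℕ, nVu j = normV (GridLeg (GridPoint L (2 * (2 * M)))) (κu j) (ρu j)
          (fun m' : ℕ => if m' = 1 then |β| / (2 * (2 * M) : ℕ) * ∑ z : TorusSite 2 L, ‖framePosKernel L (klFlowFrameU L M β U μ n) z‖ * (1 + torusSiteDist z 0)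
            else if m' = 2 then |U| * |β| / (2 * (2 * M) : ℕ) else 0)) →
      (∀ j : ℕ, cFu j = (Real.exp 2 * (κu j + ρu j)) ^ (2 * 2) * (|β| / (2 * (2 * M) : ℕ))) → (∀ j : ℕ, cgu j = Real.exp 1 * αu j * cFu j / κu j ^ 2) →
      (∀ j : ℕ, Agu j = cru j * Real.exp 1 * cFu j / (ccu j * cgu j ^ 2)) →
      (∀ j : ℕ, Pgu j = ccu j ^ 2 * cgu j / (ρu j ^ 2 * (1 - Real.exp 1 * αu j * nVu j / κu j ^ 2))) →
      (∀ j : ℕ, Auvu j = (2 : ℝ) ^ (7 * j) * Agu j / P.Klam ^ 2 / B ^ 2) → (∀ j : ℕ, Quvu j = Pgu j / (8 : ℝ) ^ j) →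
      (∀ j : ℕ, j < d → j ≤ n → Quvu j * imagTimeWeight β M ^ 2 * B * max 1 (Auvu j / imagTimeWeight β M) ≤ Qe.CE) →
      ∀ j : ℕ, j ≤ n → KernelNormsLevels L M P Qe β U μ (klFlowFrameU L M β U μ n) j := by
  obtain ⟨C₁, C₂, C₁', C₂', Cinc, Dinc, hC₁, hC₂, hC₁', hC₂', hCinc, hDinc, h⟩ := kernelNormsLevels_readoutF_klEng_sharp d c'' hc''
  refine ⟨C₁, C₂, C₁', C₂', Cinc, Dinc, hC₁, hC₂, hC₁', hC₂', hCinc, hDinc, fun R hR2 => ?_⟩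
  obtain ⟨c₃, hc₃, U₀, hU₀, Cκ, Cb, CJ, hCκ, hCb, hCJ, h'⟩ := h R hR2
  refine ⟨c₃, hc₃, U₀, hU₀, Cκ, Cb, CJ, hCκ, hCb, hCJ, ?_⟩
  intro G P Qh c hP hc hc6 hc₃' μ hμ U hU hU9 hU₀' hcU β hβmin hβc L M _ _ hL3 hM3 n hn1 hnN hreg hhist hfr hosc hd D hD cc n' hreg' hnn' B hB
    jw κ hκ hGB αw hαw hrow hcol ρ hρ hθ crw ccw hcrw hccw hrow' hcol' nV cF cg Ag Pg hnV hcF hcg hAg hPg ι₂ X hι₂ hX Ab Qb Ab' ι₂' X' hAb hQb hAb' hι₂' hX'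
    κb αb crb ccb hκb hαb hcrb hccb hDall W Z σ Φ ψ τ ι₁ hW hZ hσ hΦ hψ hτ hι₁ ρk Q' Q κA Yb Y A A' ι₃ hρk hQ' hQ hκA hYb hY hA hA' hι₃ hblock hBle
    himp₁ himp₂ hcell hUdoor hcdoor Aro Qro Qtot Atot hAro hQro hQtot hAtot Qe hCE hcard hsix
    jwu κu αu ρu cru ccu hUV nVu cFu cgu Agu Pgu Auvu Quvu hnVu hcFu hcgu hAgu hPgu hAuvu hQuvu hCEu j hj
  have hβ : 0 < β := KLRegimeSplit.pos_of_klBetaMin_le hβmin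
  by_cases hjd : j < d
  · -- block 0: RO-3's closer at `(Λ_j, F_j)`
    obtain ⟨hκu, hGBu, hαu, hrowu, hcolu, hρu, hθu, hcru, hccu, hrowu', hcolu'⟩ := hUV j hjd hj
    exact kernelNormsLevels_uvF_of_wgridStep hβ hP U hU μ (klFlowFrameU L M β U μ n) j hB (jwu j) hκu hGBu hαu hrowu hcolu hρu hθu hcru hccu
      hrowu' hcolu' (hnVu j) (hcFu j) (hcgu j) (hAgu j) (hPgu j) (hAuvu j) (hQuvu j) (hCEu j hjd hj)
  · -- block `Kb = j / d ≥ 1`: closer‴ on the flow frame, the block rows moved from `λ_{dk}` to `λ_j`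
    have hd0 : 0 < d := by omega
    have hdj : d ≤ j := not_lt.1 hjd
    set Kb : ℕ := j / d with hKbdef
    have hKb1 : 1 ≤ Kb := Nat.div_pos hdj hd0
    have hKbj : d * Kb ≤ j := Nat.mul_div_le j d
    have hjK : j ≤ d * (Kb + 1) := (Nat.lt_mul_div_succ j hd0).le
    have hKbn : d * Kb ≤ n := hKbj.trans hj
    have hjN : j ≤ nScales β + 1 := hj.trans hnN
    have hjn' : j ≤ n' := hj.trans hnn'
    have hKl : 0 ≤ P.Klam := le_trans zero_le_one hP.1
    have hB0 : 0 ≤ B := zero_le_one.trans hB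
    have hε0 : ∀ i, 0 ≤ epsCoupling P U i := fun i => by unfold epsCoupling; positivity
    have hεmono : ∀ i, i ≤ j → epsCoupling P U i ≤ epsCoupling P U j := fun i hi => by
      unfold epsCoupling
      exact mul_le_mul_of_nonneg_left ((add_le_add_iff_left |U|).2 (mul_le_mul_of_nonneg_left (Nat.cast_le.2 hi) (sq_nonneg U))) hKl
    have hι₂'0 : 0 ≤ ι₂' := by rw [hι₂']; exact div_nonneg hι₂ hB0
    have hX'0 : 0 ≤ X' := by rw [hX']; positivity
    have hkj : ∀ k, k ≤ Kb → d * k ≤ j := fun k hk => le_trans (Nat.mul_le_mul_left d hk) hKbj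
    exact h' G P Qh c hP hc hc6 hc₃' μ hμ U hU hU9 hU₀' hcU β hβmin hβc L M hL3 hM3 n hn1 hnN hreg hhist hfr hosc hd Kb D hKbn hD cc n' j hreg' hjn'
      hKb1 hKbj hjK hjN B hB jw κ hκ hGB αw hαw hrow hcol ρ hρ hθ crw ccw hcrw hccw hrow' hcol' nV cF cg Ag Pg hnV hcF hcg hAg hPg ι₂ X hι₂ hX
      Ab Qb Ab' ι₂' X' hAb hQb hAb' hι₂' hX' κb αb crb ccb hκb hαb hcrb hccb (fun k hk1 hk => hDall k hk1 ((hkj k hk.le).trans hj))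
      W Z σ Φ ψ τ ι₁ hW hZ hσ hΦ hψ hτ hι₁ ρk Q' Q κA Yb Y A A' ι₃ hρk hQ' hQ hκA hYb hY hA hA' hι₃ hblock hBle
      (fun k hk1 hk => (himp₁ k hk1 ((hkj k hk).trans hj)).trans
        (mul_le_mul_of_nonneg_left (mul_le_mul_of_nonneg_left (hεmono (d * k) (hkj k hk)) hB0) hι₁))
      (fun k hk1 hk => (himp₂ k hk1 ((hkj k hk).trans hj)).trans
        (mul_le_mul_of_nonneg_left (mul_le_mul_of_nonneg_left (hεmono (d * k) (hkj k hk)) hB0) hι₂'0))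
      (fun k hk2 hk => (hcell k hk2 ((hkj k hk).trans hj)).trans
        (mul_le_mul_of_nonneg_left (pow_le_pow_left₀ (mul_nonneg hB0 (hε0 _)) (mul_le_mul_of_nonneg_left (hεmono (d * k) (hkj k hk)) hB0) 2) hX'0))
      hUdoor hcdoor (hDall Kb hKb1 hKbn) Aro Qro Qtot (Atot j) hAro hQro hQtot (hAtot j) Qe (hCE j hdj hj) hcard (hsix j hdj hj)

end Summit.HubbardSuperconductivity.HubbardSuperconductivity.Theorems.EngineV8

end
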